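import Summits.ResolutionOfSingularities.ResolutionOfSingularities.Theorems.FrobeniusClosingSteerPowerSeriesParity
import HarnessLib

/-!
# Crux `Steer` (stmt-ResolutionOfSingularities-16345), chain W4.1 — hK4ⁿᶜ β-leaf: (C1) CANONICAL CLEANING in `R⟦X_σ⟧`,
# characteristic `2`: modulo a MONOMIAL ideal, `f + u·q²` is cleanable iff the monomials of `f` outside the parity class
# of `u` already lie in the ideal

OURS (campaign `res-hironaka`, rung L ★L-G4, slot W4.1; seat res-L0-w41-stub-4 g7; the statement is res-L0-w41-idea-1 g10's
`CANONICAL-CLEANING-g10.md` §1 CLAIM (C1), «the tool for stub-1/stub-4's parity computation of `α(r), β(r)` of ONE representative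
and for pv-003's (II)» (§0.5); K-β1♭ owner res-L0-w41-stub-1 g4, K-β2♭ owner res-D-pv-003); replaces the role of no printed item;
NOT a statement of the manuscript under review [claim: Hironaka2017, status: under-review]; AI-produced, weaker than expert review.
Theses-free and definition-free over the tree vocabulary `modComponent` / `liftExp` / `modExp` / `IsSupportedOnMultiples`
(`Literature.RingTheory.MvPowerSeries.FrobeniusPowerBasis`: the `p`-basis decomposition `f = Σ_{e : σ → Fin p} X^{ν(e)}·f_e`) and
res-D-pv-007's parity kit `…Theorems.SwitchingDichotomy.PowerSeriesParity`.

SETTING. `R⟦X_σ⟧ = MvPowerSeries σ R`, `σ` finite, `char R = 2`. A MONOMIAL IDEAL is presented, without a new definition, as an ideal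
`I` together with a support description `hI : ∀ F, F ∈ I ↔ ∀ m ∉ U, coeff m F = 0` for a set `U` of exponents (for instance
`(X_t : t ∈ T)ⁿ` with `U = {m | n ≤ Σ_{t∈T} m t}`, pv-007's `mem_pow_span_X_iff`). The TWIST is a square-free monomial
`u = X^{ν(e₀)}`, `e₀ : σ → Fin 2` (`e₀ = 0`: plain cleaning `f + q²`, the A-side gauge; `u ∈ {x, y, xy}`: the B-side twists of the
repaired letter laws, res-L0-w41-tri-2 TRIAGE v18).

* `coeff_monomial_liftExp_mul_of_isSupportedOnMultiples` — `u·G` with `G ∈ R⟦X²⟧` lives in the parity class `e₀` only.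
* `coeff_add_monomial_mul_sq_of_modExp_ne` — (P3, twisted) outside the class `e₀` the coefficients of `F + u·q²` are those of `F`
  (any `R` of characteristic `2`).
* **`exists_add_monomial_mul_sq_mem_iff`** — (C1): for `R` PERFECT, `(∃ q, F + u·q² ∈ I) ⟺ ∀ m ∉ U, m mod 2 ≠ e₀ → coeff m F = 0`
  (⇐: clean by `q` with `q² = F_{e₀}`, the `e₀`-component, a square because `R` is perfect; ⇒: (P3)).
* `exists_add_monomial_mul_sq_mem_iff_sub_mem` — the same as membership of the CANONICAL CLEANING `F − u·F_{e₀}` («delete the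
  class-`e₀` monomials») in `I`; `exists_add_sq_mem_iff`, `exists_add_sq_mem_iff_sub_modComponent_mem` — the plain case `u = 1`
  («all ODD monomials of `F` lie in `U`», `F − F₀ ∈ I`).

[cite: Matsumura1987, §30 proof of Thm. 30.9 p. 243–244] [folklore]
bears_on: LADDER-RESOLUTION L ★L-G4 W4.1 (crux `Steer`, binder hK4ⁿᶜ, debts K-β1♭ / K-β2♭ tool (C1)).
-/

noncomputable section

-- `Summit.<S>.<S>.…` duplicates the summit name by design (single-problem summit).
set_option linter.dupNamespace false

open MvPowerSeries
open Literature.RingTheory.MvPowerSeries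
open Summit.ResolutionOfSingularities.ResolutionOfSingularities.Theorems.SwitchingDichotomy.PowerSeriesParity

namespace Summit.ResolutionOfSingularities.ResolutionOfSingularities.Theorems.SwitchingDichotomy.CanonicalCleaning

universe u v

variable {σ : Type u} {R : Type v} [CommRing R] [Fintype σ]

/-! ## §1 Where `u·G`, `G ∈ R⟦X²⟧`, lives -/

/-- The coefficients of `X^{ν(e₀)} · G` for `G` supported on `2ℕ^σ`: at an exponent `m` of parity class `e₀` it is the
coefficient of `G` at `m − ν(e₀)`, and it VANISHES at every exponent of another parity class. [folklore] -/
theorem coeff_monomial_liftExp_mul_of_isSupportedOnMultiples (e₀ : σ → Fin 2) {G : MvPowerSeries σ R}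
    (hG : IsSupportedOnMultiples 2 G) (m : σ →₀ ℕ) :
    coeff m (monomial (liftExp 2 e₀) (1 : R) * G) = if modExp 2 m = e₀ then coeff (m - liftExp 2 e₀) G else 0 := by
  rw [coeff_monomial_mul, one_mul]
  by_cases hle : liftExp 2 e₀ ≤ m
  · rw [if_pos hle]
    by_cases hdvd : ∀ i, 2 ∣ (m - liftExp 2 e₀) i
    · rw [if_pos (eq_modExp_of_le_of_dvd 2 hle hdvd).symm]
    · push Not at hdvd
      rw [hG _ hdvd]
      split_ifs <;> rfl
  · rw [if_neg hle, if_neg]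
    rintro rfl
    exact hle (liftExp_modExp_le 2 m)

/-- Outside the parity class `e₀`, `X^{ν(e₀)} · G` (`G ∈ R⟦X²⟧`) has no monomials. [folklore] -/
theorem coeff_monomial_liftExp_mul_eq_zero_of_modExp_ne (e₀ : σ → Fin 2) {G : MvPowerSeries σ R}
    (hG : IsSupportedOnMultiples 2 G) {m : σ →₀ ℕ} (hm : modExp 2 m ≠ e₀) :
    coeff m (monomial (liftExp 2 e₀) (1 : R) * G) = 0 := by
  rw [coeff_monomial_liftExp_mul_of_isSupportedOnMultiples e₀ hG, if_neg hm]

/-- In the parity class `e₀`, `X^{ν(e₀)} · F_{e₀}` has the coefficients of `F` (`F_{e₀} = modComponent 2 F e₀`). [folklore] -/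
theorem coeff_monomial_liftExp_mul_modComponent_of_modExp_eq (F : MvPowerSeries σ R) {e₀ : σ → Fin 2} {m : σ →₀ ℕ}
    (hm : modExp 2 m = e₀) : coeff m (monomial (liftExp 2 e₀) (1 : R) * modComponent 2 F e₀) = coeff m F := by
  rw [coeff_monomial_liftExp_mul_of_isSupportedOnMultiples e₀ (isSupportedOnMultiples_modComponent 2 F e₀), if_pos hm,
    coeff_modComponent]
  subst hm
  rw [if_pos (dvd_sub_liftExp_modExp 2 m), tsub_add_cancel_of_le (liftExp_modExp_le 2 m)]

/-! ## §2 (P3, twisted): cleaning by `u·q²` does not touch the monomials outside the class of `u` -/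

section CharTwo

variable [CharP R 2]

/-- **Outside the parity class `e₀` the coefficients of `F + X^{ν(e₀)}·q²` are those of `F`** (characteristic `2`; `q²` is
supported on `2ℕ^σ`). [folklore] -/
theorem coeff_add_monomial_mul_sq_of_modExp_ne (F q : MvPowerSeries σ R) (e₀ : σ → Fin 2) {m : σ →₀ ℕ}
    (hm : modExp 2 m ≠ e₀) : coeff m (F + monomial (liftExp 2 e₀) (1 : R) * q ^ 2) = coeff m F := by
  haveI : Fact (Nat.Prime 2) := ⟨Nat.prime_two⟩
  rw [map_add, coeff_monomial_liftExp_mul_eq_zero_of_modExp_ne e₀ (isSupportedOnMultiples_pow_prime 2 q) hm, add_zero]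

/-- One-sided (C1), no perfectness: if `F + X^{ν(e₀)}·q²` lies in the monomial ideal `I` (support description `hI`), then every
monomial of `F` outside the class `e₀` lies in `U`. [folklore] -/
theorem forall_coeff_eq_zero_of_add_monomial_mul_sq_mem {I : Ideal (MvPowerSeries σ R)} {U : Set (σ →₀ ℕ)}
    (hI : ∀ F : MvPowerSeries σ R, F ∈ I ↔ ∀ m ∉ U, coeff m F = 0) {F q : MvPowerSeries σ R} {e₀ : σ → Fin 2}
    (h : F + monomial (liftExp 2 e₀) (1 : R) * q ^ 2 ∈ I) :
    ∀ m ∉ U, modExp 2 m ≠ e₀ → coeff m F = 0 := fun m hm hme => by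
  rw [← coeff_add_monomial_mul_sq_of_modExp_ne F q e₀ hme]
  exact (hI _).mp h m hm

/-! ## §3 (C1) over a PERFECT coefficient ring -/

variable [PerfectRing R 2]

/-- The `e₀`-component of `F` is a square over a perfect ring of characteristic `2`. [folklore] -/
theorem exists_sq_eq_modComponent (F : MvPowerSeries σ R) (e₀ : σ → Fin 2) :
    ∃ q : MvPowerSeries σ R, q ^ 2 = modComponent 2 F e₀ := by
  simpa using exists_pow_eq_of_isSupportedOnMultiples 2 (ℓ := 1)
    (by simpa using isSupportedOnMultiples_modComponent 2 F e₀)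

/-- The CANONICAL CLEANING is a cleaning: `F − X^{ν(e₀)}·F_{e₀} = F + X^{ν(e₀)}·q²` with `q² = F_{e₀}` (characteristic `2`).
[folklore] -/
theorem exists_sub_monomial_mul_modComponent_eq_add (F : MvPowerSeries σ R) (e₀ : σ → Fin 2) :
    ∃ q : MvPowerSeries σ R,
      F - monomial (liftExp 2 e₀) (1 : R) * modComponent 2 F e₀ = F + monomial (liftExp 2 e₀) (1 : R) * q ^ 2 := by
  obtain ⟨q, hq⟩ := exists_sq_eq_modComponent F e₀
  refine ⟨q, ?_⟩
  have hneg : ∀ G : MvPowerSeries σ R, -G = G := fun G => by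
    rw [neg_eq_iff_add_eq_zero]; ext m; simp [CharTwo.add_self_eq_zero]
  rw [hq, sub_eq_add_neg, hneg]

/-- **(C1) CANONICAL CLEANING** (res-L0-w41-idea-1 `CANONICAL-CLEANING-g10.md` §1): in `R⟦X_σ⟧` with `R` perfect of
characteristic `2`, for a monomial ideal `I` (support description `hI` by the exponent set `U`) and a square-free twist
`u = X^{ν(e₀)}`: **`F + u·q² ∈ I` for some `q` iff every monomial of `F` OUTSIDE the parity class `e₀` lies in `U`.**
(`e₀ = 0`, `u = 1`: plain cleaning; ⇐ cleans by the square root of the `e₀`-component, ⇒ is (P3).) OURS. [folklore] -/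
theorem exists_add_monomial_mul_sq_mem_iff {I : Ideal (MvPowerSeries σ R)} {U : Set (σ →₀ ℕ)}
    (hI : ∀ F : MvPowerSeries σ R, F ∈ I ↔ ∀ m ∉ U, coeff m F = 0) (e₀ : σ → Fin 2) (F : MvPowerSeries σ R) :
    (∃ q : MvPowerSeries σ R, F + monomial (liftExp 2 e₀) (1 : R) * q ^ 2 ∈ I) ↔
      ∀ m ∉ U, modExp 2 m ≠ e₀ → coeff m F = 0 := by
  refine ⟨fun ⟨q, hq⟩ => forall_coeff_eq_zero_of_add_monomial_mul_sq_mem hI hq, fun h => ?_⟩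
  obtain ⟨q, hq⟩ := exists_sub_monomial_mul_modComponent_eq_add F e₀
  refine ⟨q, ?_⟩
  rw [← hq, hI]
  intro m hm
  by_cases hme : modExp 2 m = e₀
  · rw [map_sub, coeff_monomial_liftExp_mul_modComponent_of_modExp_eq F hme, sub_self]
  · rw [map_sub, coeff_monomial_liftExp_mul_eq_zero_of_modExp_ne e₀ (isSupportedOnMultiples_modComponent 2 F e₀) hme,
      sub_zero]
    exact h m hm hme

/-- (C1) in the form «`∃ q, F + u·q² ∈ I` iff the CANONICAL CLEANING `F^cl_u = F − X^{ν(e₀)}·F_{e₀}` lies in `I`».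
OURS. [folklore] -/
theorem exists_add_monomial_mul_sq_mem_iff_sub_mem {I : Ideal (MvPowerSeries σ R)} {U : Set (σ →₀ ℕ)}
    (hI : ∀ F : MvPowerSeries σ R, F ∈ I ↔ ∀ m ∉ U, coeff m F = 0) (e₀ : σ → Fin 2) (F : MvPowerSeries σ R) :
    (∃ q : MvPowerSeries σ R, F + monomial (liftExp 2 e₀) (1 : R) * q ^ 2 ∈ I) ↔
      F - monomial (liftExp 2 e₀) (1 : R) * modComponent 2 F e₀ ∈ I := by
  rw [exists_add_monomial_mul_sq_mem_iff hI, hI]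
  refine forall₂_congr fun m hm => ?_
  by_cases hme : modExp 2 m = e₀
  · rw [map_sub, coeff_monomial_liftExp_mul_modComponent_of_modExp_eq F hme, sub_self]
    exact ⟨fun _ => rfl, fun _ h => absurd hme h⟩
  · rw [map_sub, coeff_monomial_liftExp_mul_eq_zero_of_modExp_ne e₀ (isSupportedOnMultiples_modComponent 2 F e₀) hme,
      sub_zero]
    exact ⟨fun h => h hme, fun h _ => h⟩

/-- **(C1), plain cleaning `u = 1`**: `F + q² ∈ I` for some `q` iff every monomial of `F` with SOME ODD EXPONENT lies in `U`.
OURS. [folklore] -/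
theorem exists_add_sq_mem_iff {I : Ideal (MvPowerSeries σ R)} {U : Set (σ →₀ ℕ)}
    (hI : ∀ F : MvPowerSeries σ R, F ∈ I ↔ ∀ m ∉ U, coeff m F = 0) (F : MvPowerSeries σ R) :
    (∃ q : MvPowerSeries σ R, F + q ^ 2 ∈ I) ↔ ∀ m ∉ U, (∃ i, Odd (m i)) → coeff m F = 0 := by
  have h0 : monomial (liftExp 2 (0 : σ → Fin 2)) (1 : R) = 1 := by
    rw [show liftExp 2 (0 : σ → Fin 2) = 0 from by ext i; simp [liftExp_apply]]; rfl
  have key := exists_add_monomial_mul_sq_mem_iff hI 0 F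
  rw [h0] at key
  simp only [one_mul] at key
  rw [key]
  refine forall₂_congr fun m _ => ?_
  have : modExp 2 m ≠ 0 ↔ ∃ i, Odd (m i) := by
    rw [Ne, funext_iff, not_forall]
    refine exists_congr fun i => ?_
    rw [Nat.odd_iff]
    change ¬ (⟨m i % 2, _⟩ : Fin 2) = 0 ↔ _
    rw [Fin.ext_iff]
    change ¬ m i % 2 = 0 ↔ _
    omega
  rw [this]

/-- (C1), plain cleaning, canonical form: `∃ q, F + q² ∈ I` iff `F − F₀ ∈ I`, `F₀ = modComponent 2 F 0` the even part.
OURS. [folklore] -/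
theorem exists_add_sq_mem_iff_sub_modComponent_mem {I : Ideal (MvPowerSeries σ R)} {U : Set (σ →₀ ℕ)}
    (hI : ∀ F : MvPowerSeries σ R, F ∈ I ↔ ∀ m ∉ U, coeff m F = 0) (F : MvPowerSeries σ R) :
    (∃ q : MvPowerSeries σ R, F + q ^ 2 ∈ I) ↔ F - modComponent 2 F 0 ∈ I := by
  have h0 : monomial (liftExp 2 (0 : σ → Fin 2)) (1 : R) = 1 := by
    rw [show liftExp 2 (0 : σ → Fin 2) = 0 from by ext i; simp [liftExp_apply]]; rfl
  have key := exists_add_monomial_mul_sq_mem_iff_sub_mem hI 0 F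
  rw [h0] at key
  simpa only [one_mul] using key

end CharTwo

end Summit.ResolutionOfSingularities.ResolutionOfSingularities.Theorems.SwitchingDichotomy.CanonicalCleaning

end
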